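import Literature.Analysis.FluidPDE.TaoCascadeRescaledEnergy
import HarnessLib

/-!
# Tao's cascade ODE, proof of Prop. 6.5 — II: initial bounds (Lemma 6.8) and the bootstrap time `T₁`

T. Tao, *Finite time blowup for an averaged three-dimensional Navier–Stokes equation*,
J. Amer. Math. Soc. 29 (2016), 601–674 (arXiv:1402.0290v3), §6.5, Lemma 6.8 and the definition of
`T₁`, p. 35. Everything here is **proved** under `RescaledHypotheses γ …` (`TaoCascadeRescaled.lean`)
and explicit parameter inequalities (`γ ≤ 10⁻⁵`, `K ≥ 2`, `ε ≤ 1`, `n₀` large):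

* **Lemma 6.8 (initial bounds)** at the rescaled time `0` (`energy_zero_before`, `_during`,
  `_after`, `energy_one_zero_le`, `abs_d_one_zero_le`);
* the bootstrap regime `GoodAt` = the four bounds defining `T₁` (p. 35: "We now define `T₁` to be
  the largest time in `[0,100]` for which one has the bounds …"), the time
  `T1 := maximalTimeP (GoodAt …) 0 100` (`Literature/Analysis/ODE/MaximalTime.lean`), and its basic
  properties: `GoodAt` holds at `0` (`goodAt_zero`) and on `[0, T₁]` (`goodAt_of_mem_T1`),
  `T₁ ∈ [0, 100]`, and the finiteness/continuity mechanism behind the exit trichotomy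
  (`eventually_goodAt_of_strict`, `T1_exit`).

Display labels (6.N) are the ordinal convention of the older `TaoCascade*` files (offset `+2` =
arXiv v3 numbering); authoritative locators are lemma numbers.

## References

* T. Tao, J. Amer. Math. Soc. 29 (2016), 601–674, §6.5 Lemma 6.8 and the definition of `T₁`
  (p. 35). [`Tao2016AveragedNS`]
-/

noncomputable section

open Set MeasureTheory intervalIntegral Filter Topology
open Literature.Analysis.ODE

namespace Literature.Analysis.FluidPDE

namespace TaoCascade

section Bootstrap

variable {γ ε₀ K ε C₁ C₂ C₃ : ℝ} {n₀ N : ℤ} {τ : ℤ → ℝ} {Xr : Fin 4 → ℤ → ℝ → ℝ} {Er : ℤ → ℝ → ℝ}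

/-! ## Lemma 6.8: initial bounds at the rescaled time `0` -/

/-- **Lemma 6.8, (6.80)**: `Ẽ_{1-m}(0) ≤ (1+ε₀)^{-0.08} K^{-10} (1+ε₀)^{m/10}` for `m ≥ 2`
(for `m ≥ 3` from (ix) at `k = 0`, shifting `m` by one; for `m = 2` from `Ẽ_{-1}(0) ≤ K^{-20}`;
when `N = n₀` the energies below scale `0` vanish). [cite: Tao2016AveragedNS, §6.5 Lemma 6.8] -/
theorem RescaledHypotheses.energy_zero_before
    (h : RescaledHypotheses γ ε₀ K ε C₁ C₂ C₃ n₀ N τ Xr Er) (hε₀ : 0 < ε₀) (hK : 1 ≤ K)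
    (hN : n₀ ≤ N) (m : ℕ) (hm : 2 ≤ m) :
    Er (1 - m) 0 ≤ (1 + ε₀) ^ (-(2 : ℝ) / 25) * ((K ^ 10)⁻¹ * (1 + ε₀) ^ ((m : ℝ) / 10)) := by
  have h0 : (0 : ℝ) < 1 + ε₀ := by linarith
  have h1 : (1 : ℝ) ≤ 1 + ε₀ := by linarith
  have hK0 : 0 < K := by linarith
  rcases Nat.lt_or_ge m 3 with hm3 | hm3
  · -- m = 2
    obtain rfl : m = 2 := by omega
    have hst := h.energy_prev_le
    have hidx : (1 : ℤ) - ((2 : ℕ) : ℤ) = -1 := by norm_num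
    rw [hidx]
    have hq : (1 : ℝ) ≤ (1 + ε₀) ^ (-(2 : ℝ) / 25) * (1 + ε₀) ^ ((((2 : ℕ) : ℝ)) / 10) := by
      rw [← Real.rpow_add h0]
      exact Real.one_le_rpow h1 (by norm_num)
    have hK20 : (K ^ 20)⁻¹ ≤ (K ^ 10)⁻¹ := by
      apply inv_anti₀ (by positivity)
      exact pow_le_pow_right₀ hK (by norm_num)
    calc Er (-1) 0 ≤ (K ^ 20)⁻¹ := hst
      _ ≤ (K ^ 10)⁻¹ * 1 := by rw [mul_one]; exact hK20
      _ ≤ (K ^ 10)⁻¹ * ((1 + ε₀) ^ (-(2 : ℝ) / 25) * (1 + ε₀) ^ ((((2 : ℕ) : ℝ)) / 10)) :=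
          mul_le_mul_of_nonneg_left hq (by positivity)
      _ = _ := by ring
  · rcases eq_or_lt_of_le hN with hNn | hNn
    · -- N = n₀: no energy below scale 0
      have hz : Er (1 - m) 0 = 0 :=
        h.noLow_F _ _ (by omega) (by rw [← hNn, sub_self, h.tau_zero])
      rw [hz]; positivity
    · have hk : n₀ - N < 0 := by omega
      have ht : (0 : ℝ) ∈ Icc (τ (0 - 1)) (τ 0) := by
        rw [h.tau_zero]; exact ⟨h.tau_le _ (by omega) (by norm_num), le_rfl⟩
      have hb := h.en_before' 0 hk le_rfl 0 ht (m - 1) (by omega)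
      have hidx : (0 : ℤ) - ((m - 1 : ℕ) : ℤ) = 1 - m := by
        rw [Nat.cast_sub (by omega)]; push_cast; ring
      rw [hidx] at hb
      have hexp : (((m - 1 : ℕ) : ℝ)) / 10 + (1 - ((0 : ℤ) : ℝ)) / 50 =
          -(2 : ℝ) / 25 + (m : ℝ) / 10 := by
        rw [Nat.cast_sub (by omega)]; push_cast; ring
      rw [hexp, Real.rpow_add h0] at hb
      linarith

/-- **Lemma 6.8, (6.82)**: `Ẽ_{1+m}(0) ≤ (1+ε₀)^{-9.98} K^{-30} (1+ε₀)^{-10m}` for `m ≥ 1`.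
[cite: Tao2016AveragedNS, §6.5 Lemma 6.8] -/
theorem RescaledHypotheses.energy_zero_after
    (h : RescaledHypotheses γ ε₀ K ε C₁ C₂ C₃ n₀ N τ Xr Er) (hε₀ : 0 < ε₀) (hK : 0 < K)
    (hN : n₀ ≤ N) (m : ℕ) (hm : 1 ≤ m) :
    Er (1 + m) 0 ≤ (1 + ε₀) ^ (-(499 : ℝ) / 50) * ((K ^ 30)⁻¹ * (1 + ε₀) ^ (-(10 : ℝ) * m)) := by
  have h0 : (0 : ℝ) < 1 + ε₀ := by linarith
  rcases eq_or_lt_of_le hN with hNn | hNn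
  · have hz : Er (1 + m) 0 = 0 := by
      have := h.init_F (1 + m) (by omega)
      rwa [← hNn, sub_self, h.tau_zero] at this
    rw [hz]; positivity
  · have hk : n₀ - N < 0 := by omega
    have ht : (0 : ℝ) ∈ Icc (τ (0 - 1)) (τ 0) := by
      rw [h.tau_zero]; exact ⟨h.tau_le _ (by omega) (by norm_num), le_rfl⟩
    have hb := h.en_after' 0 hk le_rfl 0 ht (m + 1) (by omega)
    have hidx : (0 : ℤ) + ((m + 1 : ℕ) : ℤ) = 1 + m := by push_cast; ring
    rw [hidx] at hb
    have hexp : -(10 : ℝ) * ((m + 1 : ℕ) : ℝ) + (1 - ((0 : ℤ) : ℝ)) / 50 =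
        -(499 : ℝ) / 50 + -(10 : ℝ) * m := by push_cast; ring
    rw [hexp, Real.rpow_add h0] at hb
    linarith

/-- **Lemma 6.8, (6.83) for the energy**: `Ẽ_1(0) ≤ K^{-30}`.
[cite: Tao2016AveragedNS, §6.5 Lemma 6.8] -/
theorem RescaledHypotheses.energy_one_zero_le
    (h : RescaledHypotheses γ ε₀ K ε C₁ C₂ C₃ n₀ N τ Xr Er) (hε₀ : 0 < ε₀) (hK : 0 < K)
    (hN : n₀ ≤ N) : Er 1 0 ≤ (K ^ 30)⁻¹ := by
  have h0 : (0 : ℝ) < 1 + ε₀ := by linarith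
  have h1 : (1 : ℝ) ≤ 1 + ε₀ := by linarith
  rcases eq_or_lt_of_le hN with hNn | hNn
  · have hz : Er 1 0 = 0 := by
      have := h.init_F 1 (by omega)
      rwa [← hNn, sub_self, h.tau_zero] at this
    rw [hz]; positivity
  · have hk : n₀ - N < 0 := by omega
    have ht : (0 : ℝ) ∈ Icc (τ (0 - 1)) (τ 0) := by
      rw [h.tau_zero]; exact ⟨h.tau_le _ (by omega) (by norm_num), le_rfl⟩
    have hb := h.en_after' 0 hk le_rfl 0 ht 1 le_rfl
    have hidx : (0 : ℤ) + ((1 : ℕ) : ℤ) = 1 := by norm_num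
    rw [hidx] at hb
    have hle : (1 + ε₀) ^ (-(10 : ℝ) * ((1 : ℕ) : ℝ) + (1 - ((0 : ℤ) : ℝ)) / 50) ≤ 1 :=
      Real.rpow_le_one_of_one_le_of_nonpos h1 (by norm_num)
    calc Er 1 0 ≤ (K ^ 30)⁻¹ * (1 + ε₀) ^ (-(10 : ℝ) * ((1 : ℕ) : ℝ) + (1 - ((0 : ℤ) : ℝ)) / 50) := hb
      _ ≤ (K ^ 30)⁻¹ * 1 := mul_le_mul_of_nonneg_left hle (by positivity)
      _ = _ := mul_one _

/-- **Lemma 6.8, (6.83)**: `|d_1(0)| ≤ √2 K^{-15}`. [cite: Tao2016AveragedNS, §6.5 Lemma 6.8] -/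
theorem RescaledHypotheses.abs_d_one_zero_le
    (h : RescaledHypotheses γ ε₀ K ε C₁ C₂ C₃ n₀ N τ Xr Er) (hε₀ : 0 < ε₀) (hK : 0 < K)
    (hN : n₀ ≤ N) : |Xr 3 1 0| ≤ Real.sqrt 2 * (K ^ 15)⁻¹ := by
  apply h.abs_le_of_energy_le 3 1 (h.tau_init_le hN) (by positivity)
  rw [mul_pow, Real.sq_sqrt (by norm_num : (0 : ℝ) ≤ 2)]
  have := h.energy_one_zero_le hε₀ hK hN
  have hK30 : ((K ^ 15)⁻¹) ^ 2 = (K ^ 30)⁻¹ := by rw [inv_pow, ← pow_mul]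
  rw [hK30]
  linarith

/-- **Lemma 6.8, (6.81)**: `Ẽ_0(0) + Ẽ_1(0) ≤ 0.6`, for `γ ≤ 10⁻⁵`, `K ≥ 2`, `ε ≤ 1` and `n₀` so large that
`C₂ (1+ε₀)^{-n₀/2} · cumEnergyConst ε₀ C₃ ≤ 1/100` ("recalling that `K` and `n₀` are assumed
sufficiently large"). [cite: Tao2016AveragedNS, §6.5 Lemma 6.8] -/
theorem RescaledHypotheses.energy_zero_during
    (h : RescaledHypotheses γ ε₀ K ε C₁ C₂ C₃ n₀ N τ Xr Er) (hε₀ : 0 < ε₀) (hε₀1 : ε₀ < 1)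
    (hγ1 : γ ≤ 1 / 10 ^ 5) (hK : 2 ≤ K) (hε : 0 < ε) (hε1 : ε ≤ 1) (hC₂ : 0 ≤ C₂)
    (hC₃ : 0 ≤ C₃) (hN : n₀ ≤ N)
    (hn : C₂ * (1 + ε₀) ^ (-(n₀ : ℝ) / 2) * cumEnergyConst ε₀ C₃ ≤ 1 / 100) :
    Er 0 0 + Er 1 0 ≤ 3 / 5 := by
  have h0 : (0 : ℝ) < 1 + ε₀ := by linarith
  have hK0 : 0 < K := by linarith
  have hK1 : 1 ≤ K := by linarith
  have hE1 := h.energy_one_zero_le hε₀ hK0 hN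
  have hK30 : (K ^ 30)⁻¹ ≤ 1 / 100 := by
    rw [inv_le_comm₀ (by positivity) (by norm_num)]
    calc ((1 : ℝ) / 100)⁻¹ = 100 := by norm_num
      _ ≤ 2 ^ 30 := by norm_num
      _ ≤ K ^ 30 := pow_le_pow_left₀ (by norm_num) hK 30
  -- the defect bound at `k = 0`, `t = 0`
  have hdef := h.defect_upper 0 0 (h.tau_init_le hN)
  have hcoef : C₂ * (1 + ε₀) ^ ((2 : ℝ) * ((0 : ℤ) : ℝ) - n₀ / 2) = C₂ * (1 + ε₀) ^ (-(n₀ : ℝ) / 2) := by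
    congr 2; push_cast; ring
  rw [hcoef] at hdef
  have hint := h.integral_energy_past_le_zero hε₀ hε₀1 hK1 hC₃ hN (m := 0) (by norm_num)
  have hint' : C₂ * (1 + ε₀) ^ (-(n₀ : ℝ) / 2) * ∫ s in (τ (n₀ - N))..0, Er 0 s ≤ 1 / 100 :=
    (mul_le_mul_of_nonneg_left hint (by positivity)).trans hn
  -- the sum of squares at time 0
  have ha : Xr 0 0 0 = 1 := h.a_eq
  have hb : |Xr 1 0 0| ≤ 1 / 10 ^ 5 := h.b_abs_le.trans (by nlinarith)
  have hc : |Xr 2 0 0| ≤ 1 / 10 ^ 5 := by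
    refine h.c_abs_le.trans ?_
    calc γ * ε ^ 2 ≤ 1 / 10 ^ 5 * 1 := mul_le_mul hγ1 (by nlinarith) (by positivity) (by norm_num)
      _ = 1 / 10 ^ 5 := by ring
  have hd : |Xr 3 0 0| ≤ 1 / 2 ^ 10 := by
    refine h.d_abs_le.trans ?_
    rw [one_div]
    exact inv_anti₀ (by positivity) (pow_le_pow_left₀ (by norm_num) hK 10)
  have hsq : ∀ {x c : ℝ}, |x| ≤ c → x ^ 2 ≤ c ^ 2 := fun hx =>
    (sq_abs _).symm.le.trans_eq' rfl |>.trans (pow_le_pow_left₀ (abs_nonneg _) hx 2) |> fun h => by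
      rw [← sq_abs]; exact pow_le_pow_left₀ (abs_nonneg _) hx 2
  have hsum : (1 / 2 : ℝ) * ∑ i, Xr i 0 0 ^ 2 ≤ 1 / 2 + 1 / 10 ^ 6 := by
    rw [Fin.sum_univ_four, ha]
    have := hsq hb; have := hsq hc; have := hsq hd
    nlinarith
  linarith

/-! ## The bootstrap regime `GoodAt` and the time `T₁` (§6.5) -/

/-- **The bounds defining `T₁`** (Tao, §6.5, p. 35: "We now define `T₁` to be the largest time
in `[0,100]` for which one has the bounds `Ẽ_{1-m}(t) ≤ K^{-10}(1+ε₀)^{m/10}` for all `m ≥ 2`,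
`Ẽ_0(t)+Ẽ_1(t) ≤ 1`, `Ẽ_{1+m}(t) ≤ K^{-30}(1+ε₀)^{-10m}` for all `m ≥ 1`, `|d_1(t)| ≤ ½K^{-10}`
for all `0 ≤ t ≤ T₁`"), as a predicate of the time `t`. [cite: Tao2016AveragedNS, §6.5 p. 35] -/
structure GoodAt (ε₀ K : ℝ) (Xr : Fin 4 → ℤ → ℝ → ℝ) (Er : ℤ → ℝ → ℝ) (t : ℝ) : Prop where
  /-- `Ẽ_{1-m}(t) ≤ K^{-10}(1+ε₀)^{m/10}` for all `m ≥ 2`. -/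
  before : ∀ m : ℕ, 2 ≤ m → Er (1 - m) t ≤ (K ^ 10)⁻¹ * (1 + ε₀) ^ ((m : ℝ) / 10)
  /-- `Ẽ_0(t) + Ẽ_1(t) ≤ 1`. -/
  during : Er 0 t + Er 1 t ≤ 1
  /-- `Ẽ_{1+m}(t) ≤ K^{-30}(1+ε₀)^{-10m}` for all `m ≥ 1`. -/
  after : ∀ m : ℕ, 1 ≤ m → Er (1 + m) t ≤ (K ^ 30)⁻¹ * (1 + ε₀) ^ (-(10 : ℝ) * m)
  /-- `|d_1(t)| ≤ ½ K^{-10}`. -/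
  d_le : |Xr 3 1 t| ≤ 1 / 2 * (K ^ 10)⁻¹

/-- **The time `T₁`** of §6.5: the largest time in `[0, 100]` up to which `GoodAt` holds
(`maximalTimeP`). [cite: Tao2016AveragedNS, §6.5 p. 35] -/
def T1 (ε₀ K : ℝ) (Xr : Fin 4 → ℤ → ℝ → ℝ) (Er : ℤ → ℝ → ℝ) : ℝ :=
  maximalTimeP (GoodAt ε₀ K Xr Er) 0 100

/-- **`GoodAt` holds at time `0`** (this is how Lemma 6.8 "ensures that `T₁` is well-defined"),
for `K ≥ 2`, `ε ≤ 1` and `n₀` large. [cite: Tao2016AveragedNS, §6.5 Lemma 6.8] -/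
theorem RescaledHypotheses.goodAt_zero
    (h : RescaledHypotheses γ ε₀ K ε C₁ C₂ C₃ n₀ N τ Xr Er) (hε₀ : 0 < ε₀) (hε₀1 : ε₀ < 1)
    (hγ1 : γ ≤ 1 / 10 ^ 5) (hK : 2 ≤ K) (hε : 0 < ε) (hε1 : ε ≤ 1) (hC₂ : 0 ≤ C₂) (hC₃ : 0 ≤ C₃)
    (hN : n₀ ≤ N) (hn : C₂ * (1 + ε₀) ^ (-(n₀ : ℝ) / 2) * cumEnergyConst ε₀ C₃ ≤ 1 / 100) :
    GoodAt ε₀ K Xr Er 0 := by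
  have h0 : (0 : ℝ) < 1 + ε₀ := by linarith
  have h1 : (1 : ℝ) ≤ 1 + ε₀ := by linarith
  have hK0 : 0 < K := by linarith
  have hK1 : 1 ≤ K := by linarith
  refine ⟨fun m hm => ?_, ?_, fun m hm => ?_, ?_⟩
  · have hb := h.energy_zero_before hε₀ hK1 hN m hm
    have hle : (1 + ε₀) ^ (-(2 : ℝ) / 25) ≤ 1 := Real.rpow_le_one_of_one_le_of_nonpos h1 (by norm_num)
    have hpos : 0 ≤ (K ^ 10)⁻¹ * (1 + ε₀) ^ ((m : ℝ) / 10) := by positivity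
    nlinarith
  · linarith [h.energy_zero_during hε₀ hε₀1 hγ1 hK hε hε1 hC₂ hC₃ hN hn]
  · have hb := h.energy_zero_after hε₀ hK0 hN m hm
    have hle : (1 + ε₀) ^ (-(499 : ℝ) / 50) ≤ 1 :=
      Real.rpow_le_one_of_one_le_of_nonpos h1 (by norm_num)
    have hpos : 0 ≤ (K ^ 30)⁻¹ * (1 + ε₀) ^ (-(10 : ℝ) * m) := by positivity
    nlinarith
  · have hd := h.abs_d_one_zero_le hε₀ hK0 hN
    refine hd.trans ?_
    -- `√2 K^{-15} ≤ ½ K^{-10}` iff `2√2 ≤ K^5`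
    have hs : Real.sqrt 2 ≤ 2 := by
      rw [Real.sqrt_le_left (by norm_num)]; norm_num
    have hK5 : (4 : ℝ) ≤ K ^ 5 := le_trans (by norm_num) (pow_le_pow_left₀ (by norm_num) hK 5)
    rw [show (K ^ 15)⁻¹ = (K ^ 5)⁻¹ * (K ^ 10)⁻¹ by rw [← mul_inv, ← pow_add]]
    have hK5i : (K ^ 5)⁻¹ ≤ 1 / 4 := by
      rw [one_div]; exact inv_anti₀ (by norm_num) hK5
    have hK10 : 0 < (K ^ 10)⁻¹ := by positivity
    calc Real.sqrt 2 * ((K ^ 5)⁻¹ * (K ^ 10)⁻¹) = (Real.sqrt 2 * (K ^ 5)⁻¹) * (K ^ 10)⁻¹ := by ring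
      _ ≤ 1 / 2 * (K ^ 10)⁻¹ := by
          apply mul_le_mul_of_nonneg_right _ hK10.le
          have : 0 ≤ (K ^ 5)⁻¹ := by positivity
          nlinarith

/-- Limits from the left preserve non-strict bounds of continuous functions.
[folklore] -/
theorem le_of_Ico_of_continuousOn {F : ℝ → ℝ} {a t c : ℝ} (hat : a < t)
    (hF : ContinuousOn F (Icc a t)) (hle : ∀ s ∈ Ico a t, F s ≤ c) : F t ≤ c := by
  have hcw : ContinuousWithinAt F (Ico a t) t := (hF t ⟨hat.le, le_rfl⟩).mono Ico_subset_Icc_self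
  haveI : (𝓝[Ico a t] t).NeBot := by
    rw [← mem_closure_iff_nhdsWithin_neBot, closure_Ico hat.ne]
    exact ⟨hat.le, le_rfl⟩
  exact le_of_tendsto hcw (eventually_nhdsWithin_of_forall hle)

/-- **`GoodAt` is closed under limits from the left** ("all the conditions here are closed
conditions in `t`", p. 35). [cite: Tao2016AveragedNS, §6.5 p. 35] -/
theorem RescaledHypotheses.goodAt_of_Ico
    (h : RescaledHypotheses γ ε₀ K ε C₁ C₂ C₃ n₀ N τ Xr Er) (hN : n₀ ≤ N) {t : ℝ} (ht : 0 < t)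
    (hgood : ∀ s ∈ Ico 0 t, GoodAt ε₀ K Xr Er s) : GoodAt ε₀ K Xr Er t := by
  have hτ := h.tau_init_le hN
  refine ⟨fun m hm => ?_, ?_, fun m hm => ?_, ?_⟩
  · exact le_of_Ico_of_continuousOn ht (h.continuousOn_E _ hτ) fun s hs => (hgood s hs).before m hm
  · exact le_of_Ico_of_continuousOn (F := fun s => Er 0 s + Er 1 s) ht
      ((h.continuousOn_E 0 hτ).add (h.continuousOn_E 1 hτ)) fun s hs => (hgood s hs).during
  · exact le_of_Ico_of_continuousOn ht (h.continuousOn_E _ hτ) fun s hs => (hgood s hs).after m hm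
  · exact le_of_Ico_of_continuousOn (F := fun s => |Xr 3 1 s|) ht ((h.continuousOn_X 3 1 hτ).abs)
      fun s hs => (hgood s hs).d_le

/-- `T₁ ∈ [0, 100]`. [cite: Tao2016AveragedNS, §6.5 p. 35] -/
theorem T1_mem {ε₀ K : ℝ} {Xr : Fin 4 → ℤ → ℝ → ℝ} {Er : ℤ → ℝ → ℝ} (h0 : GoodAt ε₀ K Xr Er 0) :
    T1 ε₀ K Xr Er ∈ Icc 0 100 :=
  maximalTimeP_mem (by norm_num) h0

/-- **`GoodAt` holds on `[0, T₁]`.** [cite: Tao2016AveragedNS, §6.5 p. 35] -/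
theorem RescaledHypotheses.goodAt_of_mem_T1
    (h : RescaledHypotheses γ ε₀ K ε C₁ C₂ C₃ n₀ N τ Xr Er) (hN : n₀ ≤ N)
    (h0 : GoodAt ε₀ K Xr Er 0) {t : ℝ} (ht : t ∈ Icc 0 (T1 ε₀ K Xr Er)) : GoodAt ε₀ K Xr Er t :=
  maximalTimeP_spec (by norm_num) h0 (fun _ ht' hgood => h.goodAt_of_Ico hN ht'.1 hgood) ht

/-- A good time is `≤ T₁`. [cite: Tao2016AveragedNS, §6.5 p. 35] -/
theorem le_T1_of_goodAt {ε₀ K : ℝ} {Xr : Fin 4 → ℤ → ℝ → ℝ} {Er : ℤ → ℝ → ℝ} {T : ℝ}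
    (hT : T ∈ Icc 0 100) (hgood : ∀ t ∈ Icc 0 T, GoodAt ε₀ K Xr Er t) : T ≤ T1 ε₀ K Xr Er :=
  le_maximalTimeP hT hgood

/-- **The exit principle for `T₁`**: either `T₁ = 100` or `GoodAt` is not eventually true at
`T₁` within `[0, 100]`. [cite: Tao2016AveragedNS, §6.5 p. 35] -/
theorem T1_exit {ε₀ K : ℝ} {Xr : Fin 4 → ℤ → ℝ → ℝ} {Er : ℤ → ℝ → ℝ} (h0 : GoodAt ε₀ K Xr Er 0) :
    T1 ε₀ K Xr Er = 100 ∨ ¬ ∀ᶠ t in 𝓝[Icc 0 100] (T1 ε₀ K Xr Er), GoodAt ε₀ K Xr Er t :=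
  maximalTimeP_exit (by norm_num) h0

/-- **Finitely many conditions** (Tao, p. 35: "The bounds … look like an infinite number of
conditions, but note from the qualitative decay property (6.42) that … (6.84), (6.86) are
automatically satisfied for all `m ≥ M` and some finite `M` … As `Ẽ_m` and `d_1` vary continuously
in time …"): if at a time `T ∈ [0, 100]` every condition of `GoodAt` holds *strictly*, then
`GoodAt` holds at all times of `[0, 100]` near `T`. [cite: Tao2016AveragedNS, §6.5 p. 35] -/
theorem RescaledHypotheses.eventually_goodAt_of_strict
    (h : RescaledHypotheses γ ε₀ K ε C₁ C₂ C₃ n₀ N τ Xr Er) (hε₀ : 0 < ε₀) (hK : 0 < K)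
    (hN : n₀ ≤ N) {T : ℝ} (hT : T ∈ Icc 0 100)
    (h1 : ∀ m : ℕ, 2 ≤ m → Er (1 - m) T < (K ^ 10)⁻¹ * (1 + ε₀) ^ ((m : ℝ) / 10))
    (h2 : Er 0 T + Er 1 T < 1)
    (h3 : ∀ m : ℕ, 1 ≤ m → Er (1 + m) T < (K ^ 30)⁻¹ * (1 + ε₀) ^ (-(10 : ℝ) * m))
    (h4 : |Xr 3 1 T| < 1 / 2 * (K ^ 10)⁻¹) :
    ∀ᶠ t in 𝓝[Icc 0 100] T, GoodAt ε₀ K Xr Er t := by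
  have hq0 : (0 : ℝ) < 1 + ε₀ := by linarith
  have hq1 : (1 : ℝ) < 1 + ε₀ := by linarith
  have hτ := h.tau_init_le hN
  -- a priori bound on `[τ₀, 100]`
  obtain ⟨M, hM⟩ := h.apriori_F 100 (by linarith)
  have hM' : ∀ t ∈ Icc (0 : ℝ) 100, ∀ k : ℤ,
      Er k t ≤ M ^ 2 ∧ Er k t ≤ M ^ 2 * (1 + ε₀) ^ (-(20 : ℝ) * k) := by
    intro t ht k
    have ht' : t ∈ Icc (τ (n₀ - N)) 100 := ⟨hτ.trans ht.1, ht.2⟩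
    have hb := hM t ht' k
    have hE0 : 0 ≤ Er k t := h.nonneg_F k t ht'.1
    have hs0 : 0 ≤ Real.sqrt (Er k t) := Real.sqrt_nonneg _
    have hP : 0 < (1 + ε₀) ^ ((10 : ℝ) * k) := Real.rpow_pos_of_pos hq0 _
    have hsq : Real.sqrt (Er k t) ≤ M := by nlinarith
    have hM0 : 0 ≤ M := hs0.trans hsq
    have hsq' : (1 + ε₀) ^ ((10 : ℝ) * k) * Real.sqrt (Er k t) ≤ M := by nlinarith
    constructor
    · calc Er k t = Real.sqrt (Er k t) ^ 2 := (Real.sq_sqrt hE0).symm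
        _ ≤ M ^ 2 := pow_le_pow_left₀ hs0 hsq 2
    · have hPsq : ((1 + ε₀) ^ ((10 : ℝ) * k)) ^ 2 * (1 + ε₀) ^ (-(20 : ℝ) * k) = 1 := by
        rw [sq, ← Real.rpow_add hq0, ← Real.rpow_add hq0]
        convert Real.rpow_zero (1 + ε₀) using 2; ring
      calc Er k t = ((1 + ε₀) ^ ((10 : ℝ) * k) * Real.sqrt (Er k t)) ^ 2 *
            (1 + ε₀) ^ (-(20 : ℝ) * k) := by
            rw [mul_pow, Real.sq_sqrt hE0]
            rw [mul_comm (((1 + ε₀) ^ ((10 : ℝ) * k)) ^ 2), mul_assoc, hPsq, mul_one]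
        _ ≤ M ^ 2 * (1 + ε₀) ^ (-(20 : ℝ) * k) := by
            apply mul_le_mul_of_nonneg_right _ (Real.rpow_pos_of_pos hq0 _).le
            exact pow_le_pow_left₀ (by positivity) hsq' 2
  -- thresholds beyond which the conditions are automatic
  obtain ⟨m₁, hm₁⟩ := pow_unbounded_of_one_lt (M ^ 2 * K ^ 10)
    (Real.one_lt_rpow hq1 (by norm_num : (0 : ℝ) < 1 / 10))
  obtain ⟨m₃, hm₃⟩ := pow_unbounded_of_one_lt (M ^ 2 * K ^ 30)
    (Real.one_lt_rpow hq1 (by norm_num : (0 : ℝ) < 10))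
  have hauto1 : ∀ t ∈ Icc (0 : ℝ) 100, ∀ m : ℕ, m₁ ≤ m →
      Er (1 - m) t ≤ (K ^ 10)⁻¹ * (1 + ε₀) ^ ((m : ℝ) / 10) := by
    intro t ht m hm
    have hE := (hM' t ht (1 - m)).1
    have hpow : ((1 + ε₀) ^ ((1 : ℝ) / 10)) ^ m₁ ≤ (1 + ε₀) ^ ((m : ℝ) / 10) := by
      rw [← Real.rpow_natCast, ← Real.rpow_mul hq0.le]
      apply Real.rpow_le_rpow_of_exponent_le hq1.le
      have : (m₁ : ℝ) ≤ m := by exact_mod_cast hm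
      linarith
    rw [le_inv_mul_iff₀ (by positivity)]
    calc K ^ 10 * Er (1 - m) t ≤ K ^ 10 * M ^ 2 := mul_le_mul_of_nonneg_left hE (by positivity)
      _ = M ^ 2 * K ^ 10 := by ring
      _ ≤ ((1 + ε₀) ^ ((1 : ℝ) / 10)) ^ m₁ := hm₁.le
      _ ≤ _ := hpow
  have hauto3 : ∀ t ∈ Icc (0 : ℝ) 100, ∀ m : ℕ, m₃ ≤ m →
      Er (1 + m) t ≤ (K ^ 30)⁻¹ * (1 + ε₀) ^ (-(10 : ℝ) * m) := by
    intro t ht m hm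
    have hE := (hM' t ht (1 + m)).2
    have hpow : ((1 + ε₀) ^ (10 : ℝ)) ^ m₃ ≤ (1 + ε₀) ^ ((10 : ℝ) * m) := by
      rw [← Real.rpow_natCast, ← Real.rpow_mul hq0.le]
      apply Real.rpow_le_rpow_of_exponent_le hq1.le
      have : (m₃ : ℝ) ≤ m := by exact_mod_cast hm
      nlinarith
    rw [le_inv_mul_iff₀ (by positivity)]
    have hsplit : (1 + ε₀) ^ (-(20 : ℝ) * ((1 + m : ℤ) : ℝ)) =
        (1 + ε₀) ^ (-(10 : ℝ) * m) * ((1 + ε₀) ^ ((10 : ℝ) * m) * (1 + ε₀) ^ (20 : ℝ))⁻¹ := by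
      rw [← Real.rpow_add hq0, ← Real.rpow_neg hq0.le, ← Real.rpow_add hq0]
      congr 1; push_cast; ring
    have h20 : (1 : ℝ) ≤ (1 + ε₀) ^ (20 : ℝ) := Real.one_le_rpow hq1.le (by norm_num)
    have hP10 : 0 < (1 + ε₀) ^ ((10 : ℝ) * m) := Real.rpow_pos_of_pos hq0 _
    have hP10' : 0 < (1 + ε₀) ^ (-(10 : ℝ) * m) := Real.rpow_pos_of_pos hq0 _
    calc K ^ 30 * Er (1 + m) t ≤ K ^ 30 * (M ^ 2 * (1 + ε₀) ^ (-(20 : ℝ) * ((1 + m : ℤ) : ℝ))) := by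
          have := hE; push_cast at this ⊢; exact mul_le_mul_of_nonneg_left this (by positivity)
      _ = (M ^ 2 * K ^ 30) * ((1 + ε₀) ^ ((10 : ℝ) * m) * (1 + ε₀) ^ (20 : ℝ))⁻¹ *
            (1 + ε₀) ^ (-(10 : ℝ) * m) := by rw [hsplit]; ring
      _ ≤ ((1 + ε₀) ^ ((10 : ℝ) * m)) * ((1 + ε₀) ^ ((10 : ℝ) * m) * (1 + ε₀) ^ (20 : ℝ))⁻¹ *
            (1 + ε₀) ^ (-(10 : ℝ) * m) := by
          apply mul_le_mul_of_nonneg_right _ hP10'.le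
          apply mul_le_mul_of_nonneg_right (hm₃.le.trans hpow) (by positivity)
      _ ≤ 1 * (1 + ε₀) ^ (-(10 : ℝ) * m) := by
          apply mul_le_mul_of_nonneg_right _ hP10'.le
          rw [mul_inv, ← mul_assoc, mul_inv_cancel₀ hP10.ne', one_mul]
          exact inv_le_one_of_one_le₀ h20
      _ = _ := one_mul _
  -- continuity of the finitely many remaining conditions
  have hcontE : ∀ k : ℤ, ContinuousWithinAt (Er k) (Icc 0 100) T := fun k =>
    (h.continuousOn_E k hτ).continuousWithinAt hT |>.mono fun x hx => hx
  have hcontD : ContinuousWithinAt (fun t => |Xr 3 1 t|) (Icc 0 100) T :=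
    ((h.continuousOn_X 3 1 hτ).abs).continuousWithinAt hT
  have hev1 : ∀ᶠ t in 𝓝[Icc 0 100] T, ∀ m ∈ Finset.range m₁, 2 ≤ m →
      Er (1 - m) t < (K ^ 10)⁻¹ * (1 + ε₀) ^ ((m : ℝ) / 10) := by
    rw [eventually_all_finset]
    intro m _
    by_cases hm : 2 ≤ m
    · exact ((hcontE (1 - m)).eventually_lt_const (h1 m hm)).mono fun t ht _ => ht
    · exact Eventually.of_forall fun t hm' => absurd hm' hm
  have hev2 : ∀ᶠ t in 𝓝[Icc 0 100] T, Er 0 t + Er 1 t < 1 :=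
    ((hcontE 0).add (hcontE 1)).eventually_lt_const h2
  have hev3 : ∀ᶠ t in 𝓝[Icc 0 100] T, ∀ m ∈ Finset.range m₃, 1 ≤ m →
      Er (1 + m) t < (K ^ 30)⁻¹ * (1 + ε₀) ^ (-(10 : ℝ) * m) := by
    rw [eventually_all_finset]
    intro m _
    by_cases hm : 1 ≤ m
    · exact ((hcontE (1 + m)).eventually_lt_const (h3 m hm)).mono fun t ht _ => ht
    · exact Eventually.of_forall fun t hm' => absurd hm' hm
  have hev4 : ∀ᶠ t in 𝓝[Icc 0 100] T, |Xr 3 1 t| < 1 / 2 * (K ^ 10)⁻¹ :=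
    hcontD.eventually_lt_const h4
  have hmem : ∀ᶠ t in 𝓝[Icc 0 100] T, t ∈ Icc (0 : ℝ) 100 := eventually_mem_nhdsWithin
  filter_upwards [hev1, hev2, hev3, hev4, hmem] with t ht1 ht2 ht3 ht4 htm
  refine ⟨fun m hm => ?_, ht2.le, fun m hm => ?_, ht4.le⟩
  · by_cases hmm : m < m₁
    · exact (ht1 m (Finset.mem_range.mpr hmm) hm).le
    · exact hauto1 t htm m (not_lt.mp hmm)
  · by_cases hmm : m < m₃
    · exact (ht3 m (Finset.mem_range.mpr hmm) hm).le
    · exact hauto3 t htm m (not_lt.mp hmm)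

end Bootstrap

end TaoCascade

end Literature.Analysis.FluidPDE
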